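import Summits.BirchSwinnertonDyer.Rank1Residual.ManinAdditive.CMTwinStevensMinimal
import HarnessLib

/-!
# CM TWIN STEVENS-MINIMALITY, part 2/2: the TRANSFER INCLUSION `[G:H]·Λ_f(G) ⊆ Λ_f(H)` and the NET COUNT
«one open root law per prime» (cell `bsd-f2-manin`, planner `-es` g30, MEMO-es §44.F–§44.H; T-es-47 part 2/2)

TYPER NOTE (typer g19, T-es-47).  SOURCE = HOME/es/g30/Sketch-es-g30.lean sha16 1665c8a0c824a273 §7–§8 (l. 366–578) VERBATIM except the
namespace (`…ManinAdditive.KatoCurve.CMTwinMinimal`, continued from part 1 `CMTwinStevensMinimal.lean`, which this file imports) and this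
note.  CONTENT: §7 (all PROVED, [folklore]) `pow_index_mem_map` (Lagrange in `Φ(G)/Φ(H)`), `exists_mem_cuspSymbol_eq_index_mul`,
`index_mul_mem_closure_cuspSymbol_image`, `oddSaturated_cuspSymbol_of_subgroup`, `threeSaturated_cuspSymbol_of_subgroup` = THEOREM 44.C
step (iii); §8 SUPPORTS (plain `def … : Prop`, nothing asserted) `CMRootTwistReducedTwo/Three` (classical) and `StevensGammaOneMinimalAt n`
(Stevens 1989 Conj. I″ containment at conductor `n` in consumable shape — a theorem IN PRINT at `n ≤ 200`, Thm (7.1); the cell's Literature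
fact T-es-45 is still owed: the held scan of Stevens 1989 has no text layer, so the verbatim p. 96 / Thm (7.1) hypotheses could not yet be
quoted — when it lands, a 3-line adapter feeds `StevensGammaOneMinimalAt 27/32/64`), and the PROVED net counts
`cmRootGammaOneLatticeLawTwoLocal_of_rootPeriodLaw` (E-es-136₂ ⟸ E-es-137₂ ∧ support ∧ E-es-133⁺₂ ∧ I″ at 32, 64),
`saturated_gammaOne_of_gammaZero_pointwise`, `cmRootGammaOneLatticeLawThreeLocal_of_rootPeriodLaw` (E-es-136₃ ⟸ E-es-137₃ ∧ support ∧
E-es-133⁺₃ ∧ I″ at 27).  No new conjecture in this file.  PARTITION 0 · beyond-print theorem: no · bears_on stmt-BirchSwinnertonDyer-22967 /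
22968 (CM slices) · BSD is not proved by this; C2, C3 OPEN.
-/

set_option autoImplicit false

noncomputable section

namespace Summit.BirchSwinnertonDyer.Rank1Residual.ManinAdditive.KatoCurve.CMTwinMinimal

open scoped MatrixGroups ModularForm
open CongruenceSubgroup WeierstrassCurve Literature.NumberTheory.EllipticCurves
  Literature.NumberTheory.EllipticCurves.ModularForms
  Summit.BirchSwinnertonDyer.Rank1Residual.ManinAdditive.KatoCurve.CMOptimal

/-! ## §7  TRANSFER INCLUSION `[G:H]·Λ_f(G) ⊆ Λ_f(H)` — step (iii) of THEOREM 44.C, kernel-checked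

No transfer homomorphism is needed: for a hom `Φ : G →* A` to a COMMUTATIVE group and any subgroup `H ≤ G`, the map
`G → Φ(G)/Φ(H)` is a surjective hom with kernel `H·ker Φ ⊇ H`, so `Φ(G)/Φ(H)` has order `[G : H·ker Φ] ∣ [G:H]` and Lagrange
gives `Φ(g)^[G:H] ∈ Φ(H)`.  Applied to Manin's homomorphism `cuspSymbolHom f : Γ₀(N) →* Multiplicative ℂ` (tree,
`ModularSymbolsLattice`): for every subgroup `H ≤ Γ₀(N)` and `γ ∈ Γ₀(N)` there is `δ ∈ H` with `{∞,δ∞}_f = [Γ₀(N):H]·{∞,γ∞}_f`;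
with `[Γ₀(N):H]` ODD, a `2`-saturated membership law for the `H`-periods propagates to all `Γ₀(N)`-periods (`p = 3` likewise).
In THEOREM 44.C this is used with `H = Γ₀(N_V·∏_{p ∣ gcd(a,b)} p) ≤ Γ₀(N_V)`, index `∏ p` odd. -/
section TransferInclusion

/-- LAGRANGE IN `Φ(G)/Φ(H)`: `Φ g ^ [G:H] ∈ Φ(H)` for any hom to a commutative group and any subgroup `H`
(index `0`, i.e. infinite index, gives the trivial statement). [folklore] -/
theorem pow_index_mem_map {G A : Type*} [Group G] [CommGroup A] (Φ : G →* A) (H : Subgroup G) (g : G) :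
    Φ g ^ H.index ∈ H.map Φ := by
  let ψ : G →* A ⧸ H.map Φ := (QuotientGroup.mk' (H.map Φ)).comp Φ
  have hH : H ≤ ψ.ker := by
    intro h hh
    rw [MonoidHom.mem_ker]
    show (QuotientGroup.mk' (H.map Φ)) (Φ h) = 1
    rw [QuotientGroup.mk'_apply, QuotientGroup.eq_one_iff]
    exact Subgroup.mem_map_of_mem Φ hh
  have hpow : g ^ H.index ∈ ψ.ker := by
    rw [← Subgroup.relIndex_mul_index hH, mul_comm, pow_mul]
    exact ψ.ker.pow_mem (ψ.ker.pow_index_mem g) _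
  rw [MonoidHom.mem_ker] at hpow
  have h1 : (QuotientGroup.mk' (H.map Φ)) (Φ (g ^ H.index)) = 1 := hpow
  rw [QuotientGroup.mk'_apply, QuotientGroup.eq_one_iff, map_pow] at h1
  exact h1

/-- TRANSFER INCLUSION for Manin's homomorphism: for every subgroup `H ≤ Γ₀(N)` and `γ ∈ Γ₀(N)` some `δ ∈ H` has
`{∞, δ∞}_f = [Γ₀(N) : H] · {∞, γ∞}_f`. [folklore] -/
theorem exists_mem_cuspSymbol_eq_index_mul {N : ℕ} [NeZero N] (f : CuspForm (Gamma0 N) 2)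
    (H : Subgroup (Gamma0 N)) (γ : Gamma0 N) :
    ∃ δ ∈ H, cuspSymbol f δ = (H.index : ℂ) * cuspSymbol f γ := by
  obtain ⟨δ, hδ, h⟩ := (Subgroup.mem_map).mp (pow_index_mem_map (cuspSymbolHom f) H γ)
  refine ⟨δ, hδ, ?_⟩
  have h' : Multiplicative.ofAdd (cuspSymbol f δ) = Multiplicative.ofAdd (H.index • cuspSymbol f γ) := by
    rw [ofAdd_nsmul]; simpa [cuspSymbolHom_apply] using h
  have h'' := Multiplicative.ofAdd.injective h'
  rw [h'', nsmul_eq_mul]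

/-- Lattice form: `[Γ₀(N):H] · Λ_f ⊆ ⟨{∞, δ∞}_f : δ ∈ H⟩`. [folklore] -/
theorem index_mul_mem_closure_cuspSymbol_image {N : ℕ} [NeZero N] (f : CuspForm (Gamma0 N) 2)
    (H : Subgroup (Gamma0 N)) {z : ℂ} (hz : z ∈ periodLattice f) :
    (H.index : ℂ) * z ∈ AddSubgroup.closure (cuspSymbol f '' (H : Set (Gamma0 N))) := by
  refine AddSubgroup.closure_induction
    (p := fun w _ => (H.index : ℂ) * w ∈ AddSubgroup.closure (cuspSymbol f '' (H : Set (Gamma0 N)))) ?_ ?_ ?_ ?_ hz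
  · rintro _ ⟨γ, rfl⟩
    obtain ⟨δ, hδ, hδγ⟩ := exists_mem_cuspSymbol_eq_index_mul f H γ
    rw [← hδγ]
    exact AddSubgroup.subset_closure ⟨δ, hδ, rfl⟩
  · simp
  · intro x y _ _ hx hy
    simpa [mul_add] using AddSubgroup.add_mem _ hx hy
  · intro x _ hx
    simpa [mul_neg] using AddSubgroup.neg_mem _ hx

/-- ODD-INDEX PROPAGATION (the form THEOREM 44.C (iii) consumes at `p = 2`): if `[Γ₀(N):H]` is odd and an odd multiple of
every `H`-period lies in `Λ`, then an odd multiple of every `Γ₀(N)`-period lies in `Λ`. [folklore] -/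
theorem oddSaturated_cuspSymbol_of_subgroup {N : ℕ} [NeZero N] (f : CuspForm (Gamma0 N) 2) (L : PeriodPair)
    (H : Subgroup (Gamma0 N)) (hodd : ¬ (2 : ℤ) ∣ (H.index : ℤ))
    (hH : ∀ δ ∈ H, ∃ s : ℤ, ¬ (2 : ℤ) ∣ s ∧ (s : ℂ) * cuspSymbol f δ ∈ L.lattice) :
    ∀ γ : Gamma0 N, ∃ s : ℤ, ¬ (2 : ℤ) ∣ s ∧ (s : ℂ) * cuspSymbol f γ ∈ L.lattice := by
  intro γ
  obtain ⟨δ, hδ, hδγ⟩ := exists_mem_cuspSymbol_eq_index_mul f H γ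
  obtain ⟨s, hs, hsδ⟩ := hH δ hδ
  refine ⟨s * H.index, ?_, ?_⟩
  · rintro h2
    rcases (Int.prime_two.dvd_mul).1 h2 with h | h
    · exact hs h
    · exact hodd h
  · have e : ((s * (H.index : ℤ) : ℤ) : ℂ) * cuspSymbol f γ = (s : ℂ) * cuspSymbol f δ := by
      rw [hδγ]; push_cast; ring
    rw [e]; exact hsδ

/-- Same at `p = 3` (THEOREM 44.C, `j = 0` half). [folklore] -/
theorem threeSaturated_cuspSymbol_of_subgroup {N : ℕ} [NeZero N] (f : CuspForm (Gamma0 N) 2) (L : PeriodPair)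
    (H : Subgroup (Gamma0 N)) (h3 : ¬ (3 : ℤ) ∣ (H.index : ℤ))
    (hH : ∀ δ ∈ H, ∃ s : ℤ, ¬ (3 : ℤ) ∣ s ∧ (s : ℂ) * cuspSymbol f δ ∈ L.lattice) :
    ∀ γ : Gamma0 N, ∃ s : ℤ, ¬ (3 : ℤ) ∣ s ∧ (s : ℂ) * cuspSymbol f γ ∈ L.lattice := by
  intro γ
  obtain ⟨δ, hδ, hδγ⟩ := exists_mem_cuspSymbol_eq_index_mul f H γ
  obtain ⟨s, hs, hsδ⟩ := hH δ hδ
  refine ⟨s * H.index, ?_, ?_⟩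
  · rintro h2
    rcases (Int.prime_three.dvd_mul).1 h2 with h | h
    · exact hs h
    · exact h3 h
  · have e : ((s * (H.index : ℤ) : ℤ) : ℂ) * cuspSymbol f γ = (s : ℂ) * cuspSymbol f δ := by
      rw [hδγ]; push_cast; ring
    rw [e]; exact hsδ

end TransferInclusion

/-! ## §8  NET COUNT — ONE OPEN ROOT LAW: E-es-136₂ ⟸ E-es-137₂ (off conductors 32, 64) ∧ Stevens' I″ (at 32, 64, in print)

On a root class `K_a = {E_a, E_{−4a}}` the `Γ₁`-law E-es-136₂ is WEAKER than the `Γ₀`-law E-es-137₂ (`Λ₁(f) ≤ Λ_f`), and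
at the two excluded roots `a = ±1` (conductors 32, 64) it is Stevens' Conjecture I″ containment `Λ₁(f) ⊆ Λ(E_min)`, a
theorem in print (Stevens 1989 Thm (7.1); cell fact T-es-45).  So after §4 (E-es-135 deleted) and §6/THEOREM 44.C (the
band law ⟸ the root `Γ₁`-law), the WHOLE `ℚ(i)`-CM slice of C2 rests on ONE open one-parameter law, E-es-137₂
(«`Λ_f ⊗ ℤ₍₂₎ ⊆ Λ(E_a) ⊗ ℤ₍₂₎` for squarefree `a ∉ {±1}`», i.e. `E₀(K_a) = E_a ∧ 2 ∤ c₀`), plus: E-es-133⁺₂ (provable),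
the classification support `CMRootTwistReducedTwo` (classical), Stevens (7.1) at 32/64 (print), COR 6⁺ (kernel) and
THEOREM 44.C (paper; step (iii) kernel, §7).  This section kernel-checks that count. -/
section NetCount

/-- SUPPORT `CMRootTwistReducedTwo` (classical — imaginary-quadratic class number one + Vélu: the `j = 1728` members of the
class of a squarefree root `E_a : c₄ = −48a, c₆ = 0` are `E_a` and `E_{−4a}` (`c₄ = 192a = −4·c₄(E_a)`), at `a = ±1` too:
32a1/32a2 = `E_4`/`E_{−1}`, 64a1/64a4 = `E_{−4}`/`E_1`; BC5: CM-REROOT-v1, all 125 root classes `N < 5·10⁵`). [folklore] -/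
def CMRootTwistReducedTwo : Prop :=
  ∀ (V : WeierstrassCurve ℚ) [V.IsElliptic] [V.IsGloballyMinimal],
    (∃ a : ℤ, Squarefree a ∧ V.c₄ = -48 * (a : ℚ) ∧ V.c₆ = 0) →
    ∀ (W' : WeierstrassCurve ℚ) [W'.IsElliptic] [W'.IsGloballyMinimal],
      W'.j = 1728 → WeierstrassCurve.IsIsogenous V W' → (W'.c₄ = V.c₄ ∨ W'.c₄ = -4 * V.c₄)

/-- `StevensGammaOneMinimalAt n` — Stevens' Conjecture I″ CONTAINMENT at conductor `n`, in the form the edge consumes: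
for a globally minimal `V` of conductor `n` that is LATTICE-MINIMAL in its class (`Λ(V) ⊆ Λ(W)` for every globally
minimal isogenous `W`; Stevens 1989 Thm 2.3: = minimal Faltings height = étale-minimal), every `Γ₁`-period of its newform
lies in `Λ(V)`.  A THEOREM IN PRINT at `n = 32, 64` (and 27, 36, …: Stevens 1989 Thm (7.1), conductor `≤ 200`; cell fact
T-es-45); typed here as a hypothesis, nothing asserted. [cite: Stevens1989, Thm. (7.1) and Thm. 2.3 (shape: I″ for the classes of conductor ≤ 200; here only the containment Λ₁(f) ⊆ Λ(E_min) at n = 32, 64 is consumed)] -/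
def StevensGammaOneMinimalAt (n : ℕ) : Prop :=
  ∀ (V : WeierstrassCurve ℚ) [V.IsElliptic] [V.IsGloballyMinimal] {N : ℕ} [NeZero N]
    (f : CuspForm (Gamma0 N) 2) (L : PeriodPair),
    V.conductorNorm ℤ = n → IsNewformOf V f → IsNeronLatticeOf (V.baseChange ℂ) L →
    (∀ (W : WeierstrassCurve ℚ) [W.IsElliptic] [W.IsGloballyMinimal] (LW : PeriodPair),
        WeierstrassCurve.IsIsogenous V W → IsNeronLatticeOf (W.baseChange ℂ) LW → L.lattice ≤ LW.lattice) →
    ∀ z ∈ periodLatticeGamma1 f, z ∈ L.lattice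

/-- **NET COUNT (kernel): E-es-136₂ ⟸ E-es-137₂ ∧ `CMRootTwistReducedTwo` ∧ E-es-133⁺₂ ∧ Stevens I″ at 32 and 64.**
Off conductors 32/64 the `Γ₀`-law gives the `Γ₁`-law through `Λ₁(f) ≤ Λ_f` (`cmRootGammaOne_of_gammaZero_pointwise`); at
32/64 the root twin is lattice-minimal by E-es-133⁺₂ (its twist-reduced clause supplied by `CMRootTwistReducedTwo`), so
Stevens' containment applies with `s = 1`.  `V.j = 1728` is read off `c₆ = 0` (tree `j_eq_1728_iff_c₆_eq_zero`). -/
theorem cmRootGammaOneLatticeLawTwoLocal_of_rootPeriodLaw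
    (h137 : CMRootPeriodLatticeLawTwoLocal) (hred : CMRootTwistReducedTwo) (hmin : CMTwinStevensMinimalTwo)
    (h32 : StevensGammaOneMinimalAt 32) (h64 : StevensGammaOneMinimalAt 64) :
    CMRootGammaOneLatticeLawTwoLocal := by
  intro V _ _ N _ f L hroot hf hL z hz
  obtain ⟨a, ha, hc₄, hc₆⟩ := hroot
  have hj : V.j = 1728 := (Literature.AlgebraicGeometry.PlaneCurves.j_eq_1728_iff_c₆_eq_zero V).2 hc₆
  have hclause := hred V ⟨a, ha, hc₄, hc₆⟩
  by_cases hc : V.conductorNorm ℤ = 32 ∨ V.conductorNorm ℤ = 64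
  · -- the excluded roots: Stevens' I″ containment, `s = 1`
    have hVmin : ∀ (W : WeierstrassCurve ℚ) [W.IsElliptic] [W.IsGloballyMinimal] (LW : PeriodPair),
        WeierstrassCurve.IsIsogenous V W → IsNeronLatticeOf (W.baseChange ℂ) LW → L.lattice ≤ LW.lattice :=
      fun W _ _ LW hiso hLW => hmin V W L LW hj hiso hL hLW hclause
    refine ⟨1, by decide, ?_⟩
    rcases hc with h | h
    · simpa using h32 V f L h hf hL hVmin z hz
    · simpa using h64 V f L h hf hL hVmin z hz
  · have hc' : V.conductorNorm ℤ ≠ 32 ∧ V.conductorNorm ℤ ≠ 64 := by simpa [not_or] using hc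
    exact cmRootGammaOne_of_gammaZero_pointwise f L
      (h137 V f L ⟨a, ha, hc₄, hc₆⟩ hj hf hL hclause hc'.1 hc'.2) z hz

/-- `p = 3` / general-prime version of `cmRootGammaOne_of_gammaZero_pointwise`: a `p`-saturated membership law for the
`Γ₀(N)`-periods gives the same for the `Γ₁(N)`-periods (`Λ₁(f) ≤ Λ_f`, closure induction). [folklore] -/
theorem saturated_gammaOne_of_gammaZero_pointwise {p : ℤ} (hp : Prime p) {N : ℕ} [NeZero N]
    (f : CuspForm (Gamma0 N) 2) (L : PeriodPair)
    (h : ∀ γ : Gamma0 N, ∃ s : ℤ, ¬ p ∣ s ∧ (s : ℂ) * cuspSymbol f γ ∈ L.lattice) :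
    ∀ z ∈ periodLatticeGamma1 f, ∃ s : ℤ, ¬ p ∣ s ∧ (s : ℂ) * z ∈ L.lattice := by
  intro z hz
  have hz' : z ∈ periodLattice f := periodLatticeGamma1_le_periodLattice f hz
  refine AddSubgroup.closure_induction (p := fun w _ => ∃ s : ℤ, ¬ p ∣ s ∧ (s : ℂ) * w ∈ L.lattice)
    ?_ ?_ ?_ ?_ hz'
  · rintro _ ⟨γ, rfl⟩
    exact h γ
  · exact ⟨1, fun h1 => hp.not_unit (isUnit_of_dvd_one h1), by simp⟩
  · rintro x y _ _ ⟨s, hs, hsx⟩ ⟨t, ht, hty⟩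
    refine ⟨s * t, ?_, ?_⟩
    · intro h2
      rcases hp.dvd_mul.1 h2 with h | h
      · exact hs h
      · exact ht h
    · have hx' : ((s * t : ℤ) : ℂ) * x ∈ L.lattice := by
        have e : ((s * t : ℤ) : ℂ) * x = (t : ℤ) • ((s : ℂ) * x) := by
          rw [zsmul_eq_mul]; push_cast; ring
        rw [e]; exact L.lattice.smul_mem t hsx
      have hy' : ((s * t : ℤ) : ℂ) * y ∈ L.lattice := by
        have e : ((s * t : ℤ) : ℂ) * y = (s : ℤ) • ((t : ℂ) * y) := by
          rw [zsmul_eq_mul]; push_cast; ring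
        rw [e]; exact L.lattice.smul_mem s hty
      simpa [mul_add] using L.lattice.add_mem hx' hy'
  · rintro x _ ⟨s, hs, hsx⟩
    exact ⟨s, hs, by simpa [mul_neg] using L.lattice.neg_mem hsx⟩

/-- SUPPORT `CMRootTwistReducedThree` (classical: the `j = 0` members of the class of a root `E_B : c₄ = 0, c₆ = −864B` (root
binder as in E-es-136₃/137₃) have `c₆ ∈ {c₆(E_B), −27·c₆(E_B)}` — `E_B` and its 3-isogenous partner `E_{−27B}`; at conductor 27
too: 27a3/27a1).  BC5: CM-REROOT-v1, the `j = 0` root classes `N < 5·10⁵`. [folklore] -/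
def CMRootTwistReducedThree : Prop :=
  ∀ (V : WeierstrassCurve ℚ) [V.IsElliptic] [V.IsGloballyMinimal],
    (∃ B : ℚ, B ≠ 0 ∧ V.c₄ = 0 ∧ V.c₆ = -864 * B ∧ padicValRat 3 B ≤ 2 ∧
        ∀ p : ℕ, p.Prime → 5 ≤ p → padicValRat p B ≤ 2) →
    ∀ (W' : WeierstrassCurve ℚ) [W'.IsElliptic] [W'.IsGloballyMinimal],
      W'.j = 0 → WeierstrassCurve.IsIsogenous V W' → (W'.c₆ = V.c₆ ∨ W'.c₆ = -27 * V.c₆)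

/-- **NET COUNT at `p = 3` (kernel): E-es-136₃ ⟸ E-es-137₃ ∧ `CMRootTwistReducedThree` ∧ E-es-133⁺₃ ∧ Stevens I″ at 27.**
So C3 on the whole `ℚ(√−3)`-CM slice rests on the ONE open one-parameter law E-es-137₃ (root classes off conductor 27). -/
theorem cmRootGammaOneLatticeLawThreeLocal_of_rootPeriodLaw
    (h137 : CMRootPeriodLatticeLawThreeLocal) (hred : CMRootTwistReducedThree) (hmin : CMTwinStevensMinimalThree)
    (h27 : StevensGammaOneMinimalAt 27) :
    CMRootGammaOneLatticeLawThreeLocal := by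
  intro V _ _ N _ f L hroot hf hL z hz
  obtain ⟨B, hB, hc₄, hc₆, h3, h5⟩ := hroot
  have hj : V.j = 0 := (WeierstrassCurve.j_eq_zero_iff V).2 hc₄
  have hclause := hred V ⟨B, hB, hc₄, hc₆, h3, h5⟩
  by_cases hc : V.conductorNorm ℤ = 27
  · have hVmin : ∀ (W : WeierstrassCurve ℚ) [W.IsElliptic] [W.IsGloballyMinimal] (LW : PeriodPair),
        WeierstrassCurve.IsIsogenous V W → IsNeronLatticeOf (W.baseChange ℂ) LW → L.lattice ≤ LW.lattice :=
      fun W _ _ LW hiso hLW => hmin V W L LW hj hiso hL hLW hclause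
    refine ⟨1, by decide, ?_⟩
    simpa using h27 V f L hc hf hL hVmin z hz
  · exact saturated_gammaOne_of_gammaZero_pointwise Int.prime_three f L
      (h137 V f L ⟨B, hB, hc₄, hc₆, h3, h5⟩ hj hf hL hclause hc) z hz

end NetCount

end Summit.BirchSwinnertonDyer.Rank1Residual.ManinAdditive.KatoCurve.CMTwinMinimal

end
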